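import Mathlib.RingTheory.MvPolynomial.Localization
import Mathlib.RingTheory.Jacobson.Ring
import Mathlib.FieldTheory.IsAlgClosed.AlgebraicClosure
import Mathlib.RingTheory.Localization.FractionRing
import Mathlib.RingTheory.Localization.Integer
import Mathlib.Algebra.MvPolynomial.Funext
import HarnessLib

/-!
# Numeric-to-symbolic transfer, I: generic solvability (Garg–Makam–Oliveira–Wigderson 2019, Prop. 3.3)

Let `F` be an algebraically closed field, `L : F^σ → F^ι` and `M : F^τ → F^ι` polynomial maps
(given by their coordinate polynomials `L i ∈ F[z_σ]`, `M i ∈ F[y_τ]`) with `im L ⊆ im M`, i.e.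
for every `β ∈ F^σ` the system `M(y) = L(β)` has a solution `γ ∈ F^τ`. Put `A = F[z]`,
`K = F(z) = Frac A` and let `K̄` be an algebraic closure of `K`.

**Proposition 3.3** of [GargMakamOliveiraWigderson2019] (`exists_generic_solution`): there are
algebraic functions `b ∈ K̄^τ` with `M(b) = L(z)` in `K̄^ι` — the generic point of `F^σ` also lands
in the image of `M`, after passing to the algebraic closure of the function field ("The need to pass
to the algebraic closure is already evident", §3.2: `L(x) = x = M(√x)` for `M(y) = y²`).

## Proof

The printed proof (§4.1) applies Hilbert's Nullstellensatz over `K̄` and specialises the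
coefficients of a certificate `Σ fᵢ (Mᵢ - Lᵢ) = 1` through an `F`-point of the finitely generated
ring they generate. We prove the same statement by the equivalent "generic fibre" route, which is
shorter in Mathlib:

* `span_fibreEqn_ne_top`: the ideal `J = (Mᵢ(y) - Lᵢ(z))ᵢ ⊆ K[y]` is proper. Otherwise
  `1 = Σ hᵢ (Mᵢ - Lᵢ)` with `hᵢ ∈ K[y]`; since `K[y]` is the localisation of `A[y]` at the non-zero
  constants (`MvPolynomial.isLocalization`), clearing denominators gives `a = Σ Hᵢ (Mᵢ - Lᵢ)` in
  `A[y]` with `0 ≠ a ∈ A`; evaluating at `(β, γ)` with `M(γ) = L(β)` gives `a(β) = 0` for all `β`,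
  so `a = 0` (`F` infinite), a contradiction.
* `exists_generic_solution`: a maximal ideal `m ⊇ J` has residue field `E = K[y]/m` of finite type,
  hence finite over `K` (Zariski's lemma, `finite_of_finite_type_of_isJacobsonRing`), hence `E`
  embeds into `K̄` over `K` (`IsAlgClosed.lift`); the images of the `yⱼ` are the required `bⱼ`.

Only `F` infinite is needed for the first step and nothing beyond `Field F` for the second; we
state the proposition for an arbitrary infinite field `F` (the paper assumes `F` algebraically
closed, which implies infinite).

## References

* [GargMakamOliveiraWigderson2019] A. Garg, V. Makam, R. Oliveira, A. Wigderson, *More barriers for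
  rank methods, via a "numeric to symbolic" transfer*, FOCS 2019, arXiv:1904.04299; Prop. 3.3
  (statement §3.2, proof §4.1, Remark 4.2 for the generic-point formulation used here).
-/

noncomputable section

namespace Literature.RingTheory.PolynomialMaps

open MvPolynomial

variable {F : Type*} [Field F] {σ τ ι : Type*}

/-- The polynomial map `L : F^σ → F^ι` has image inside that of `M : F^τ → F^ι`: every system
`M(y) = L(β)`, `β ∈ F^σ`, has a solution in `F^τ` (the hypothesis `im(L) ⊆ im(M)` of
[GargMakamOliveiraWigderson2019, Thm. 1.21 and Prop. 3.3]). [cite: GargMakamOliveiraWigderson2019, Prop. 3.3] -/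
def ImageSubset (L : ι → MvPolynomial σ F) (M : ι → MvPolynomial τ F) : Prop :=
  ∀ β : σ → F, ∃ γ : τ → F, ∀ i, eval γ (M i) = eval β (L i)

/-- Unfolding lemma for `ImageSubset`. [cite: GargMakamOliveiraWigderson2019, Prop. 3.3] -/
theorem imageSubset_iff (L : ι → MvPolynomial σ F) (M : ι → MvPolynomial τ F) :
    ImageSubset L M ↔ ∀ β : σ → F, ∃ γ : τ → F, ∀ i, eval γ (M i) = eval β (L i) :=
  Iff.rfl

/-- The equations `Mᵢ(y) - Lᵢ(z)` with coefficients in `A = F[z]`, as polynomials in `y` over `A`.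
[cite: GargMakamOliveiraWigderson2019, §4.1] -/
def fibreEqn (L : ι → MvPolynomial σ F) (M : ι → MvPolynomial τ F) (i : ι) :
    MvPolynomial τ (MvPolynomial σ F) :=
  map (algebraMap F (MvPolynomial σ F)) (M i) - C (L i)

/-- Evaluating the equation `Mᵢ(y) - Lᵢ(z)` at `z = β`, `y = γ` gives `Mᵢ(γ) - Lᵢ(β)`.
[cite: GargMakamOliveiraWigderson2019, §4.1] -/
theorem eval₂Hom_eval_fibreEqn (L : ι → MvPolynomial σ F) (M : ι → MvPolynomial τ F) (i : ι)
    (β : σ → F) (γ : τ → F) :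
    eval₂Hom (eval β) γ (fibreEqn L M i) = eval γ (M i) - eval β (L i) := by
  simp only [fibreEqn, map_sub, coe_eval₂Hom, eval₂_C]
  congr 1
  rw [eval₂_map]
  have : (eval β).comp (algebraMap F (MvPolynomial σ F)) = RingHom.id F := by
    ext x
    simp
  rw [this]
  rfl

/-- **Properness of the generic fibre ideal.** If `im L ⊆ im M` over an infinite field `F`, the
ideal generated by the `Mᵢ(y) - Lᵢ(z)` in `K[y]`, `K = Frac F[z]`, is proper.
[cite: GargMakamOliveiraWigderson2019, Prop. 3.3 (proof, §4.1)] -/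
theorem span_fibreEqn_ne_top [Infinite F] [Finite ι] (L : ι → MvPolynomial σ F)
    (M : ι → MvPolynomial τ F) (hLM : ImageSubset L M) (K : Type*) [Field K]
    [Algebra (MvPolynomial σ F) K] [IsFractionRing (MvPolynomial σ F) K] :
    Ideal.span (Set.range fun i => map (algebraMap (MvPolynomial σ F) K) (fibreEqn L M i)) ≠ ⊤ := by
  classical
  haveI : Fintype ι := Fintype.ofFinite ι
  intro htop
  have h1 : (1 : MvPolynomial τ K) ∈
      Ideal.span (Set.range fun i => map (algebraMap (MvPolynomial σ F) K) (fibreEqn L M i)) := by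
    rw [htop]; exact Submodule.mem_top
  obtain ⟨h, hh⟩ := Ideal.mem_span_range_iff_exists_fun.1 h1
  -- clear denominators: `K[y]` is the localisation of `A[y]` at the non-zero constants
  letI : Algebra (MvPolynomial τ (MvPolynomial σ F)) (MvPolynomial τ K) :=
    MvPolynomial.algebraMvPolynomial
  haveI : IsLocalization ((nonZeroDivisors (MvPolynomial σ F)).map
      (C : MvPolynomial σ F →+* MvPolynomial τ (MvPolynomial σ F))) (MvPolynomial τ K) :=
    MvPolynomial.isLocalization _ _
  obtain ⟨⟨b, hb⟩, hbint⟩ := IsLocalization.exist_integer_multiples_of_finite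
    ((nonZeroDivisors (MvPolynomial σ F)).map
      (C : MvPolynomial σ F →+* MvPolynomial τ (MvPolynomial σ F))) h
  obtain ⟨a, ha, rfl⟩ := Submonoid.mem_map.1 hb
  choose H hH using hbint
  have hHmap : ∀ i, map (algebraMap (MvPolynomial σ F) K) (H i) =
      map (algebraMap (MvPolynomial σ F) K) (C a) * h i := by
    intro i
    have := hH i
    rw [algebraMap_def] at this
    rw [this, Algebra.smul_def, algebraMap_def]
  have key : map (algebraMap (MvPolynomial σ F) K) (C a) =
      map (algebraMap (MvPolynomial σ F) K) (∑ i, H i * fibreEqn L M i) := by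
    rw [map_sum]
    simp_rw [map_mul, hHmap, mul_assoc, ← Finset.mul_sum, hh, mul_one]
  have key2 : C a = ∑ i, H i * fibreEqn L M i :=
    map_injective _ (IsFractionRing.injective (MvPolynomial σ F) K) key
  -- specialise at every `β`
  have hzero : ∀ β : σ → F, eval β a = 0 := by
    intro β
    obtain ⟨γ, hγ⟩ := hLM β
    have hG : ∀ i, eval₂Hom (eval β) γ (fibreEqn L M i) = 0 := fun i => by
      rw [eval₂Hom_eval_fibreEqn, hγ i, sub_self]
    have := congrArg (eval₂Hom (eval β) γ) key2
    rw [map_sum] at this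
    simp only [map_mul, hG, mul_zero, Finset.sum_const_zero, eval₂Hom_C] at this
    exact this
  have ha0 : a = 0 := MvPolynomial.funext fun β => by simpa using hzero β
  exact nonZeroDivisors.ne_zero ha ha0

/-- **Garg–Makam–Oliveira–Wigderson 2019, Proposition 3.3 (symbolic solution by algebraic
functions).** Let `F` be an infinite field (e.g. algebraically closed), `L : F^σ → F^ι` and
`M : F^τ → F^ι` polynomial maps with `im L ⊆ im M`, `τ` and `ι` finite. Then over the algebraic
closure `K̄` of `K = F(z_σ)` there are `b ∈ K̄^τ` with `M(b) = L(z)`: for every `i`,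
`Mᵢ(b) = Lᵢ(z)` in `K̄`. [cite: GargMakamOliveiraWigderson2019, Prop. 3.3] -/
theorem exists_generic_solution [Infinite F] [Finite τ] [Finite ι] (L : ι → MvPolynomial σ F)
    (M : ι → MvPolynomial τ F) (hLM : ImageSubset L M) :
    ∃ b : τ → AlgebraicClosure (FractionRing (MvPolynomial σ F)), ∀ i,
      aeval b (M i) =
        algebraMap (MvPolynomial σ F) (AlgebraicClosure (FractionRing (MvPolynomial σ F))) (L i) := by
  classical
  obtain ⟨m, hm, hJm⟩ := Ideal.exists_le_maximal _
    (span_fibreEqn_ne_top L M hLM (FractionRing (MvPolynomial σ F)))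
  letI : Field (MvPolynomial τ (FractionRing (MvPolynomial σ F)) ⧸ m) := Ideal.Quotient.field m
  haveI : Module.Finite (FractionRing (MvPolynomial σ F))
      (MvPolynomial τ (FractionRing (MvPolynomial σ F)) ⧸ m) :=
    finite_of_finite_type_of_isJacobsonRing _ _
  haveI : Algebra.IsAlgebraic (FractionRing (MvPolynomial σ F))
      (MvPolynomial τ (FractionRing (MvPolynomial σ F)) ⧸ m) :=
    Algebra.IsAlgebraic.of_finite _ _
  let ψ : (MvPolynomial τ (FractionRing (MvPolynomial σ F)) ⧸ m) →ₐ[FractionRing (MvPolynomial σ F)]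
      AlgebraicClosure (FractionRing (MvPolynomial σ F)) :=
    IsAlgClosed.lift
  let Φ : MvPolynomial τ (FractionRing (MvPolynomial σ F)) →ₐ[FractionRing (MvPolynomial σ F)]
      AlgebraicClosure (FractionRing (MvPolynomial σ F)) :=
    ψ.comp (Ideal.Quotient.mkₐ _ m)
  refine ⟨fun j => Φ (X j), fun i => ?_⟩
  have hmem : map (algebraMap (MvPolynomial σ F) (FractionRing (MvPolynomial σ F)))
      (fibreEqn L M i) ∈ m :=
    hJm (Ideal.subset_span ⟨i, rfl⟩)
  have hΦ0 : Φ (map (algebraMap (MvPolynomial σ F) (FractionRing (MvPolynomial σ F)))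
      (fibreEqn L M i)) = 0 := by
    change ψ (Ideal.Quotient.mk m (map (algebraMap (MvPolynomial σ F) _) (fibreEqn L M i))) = 0
    rw [Ideal.Quotient.eq_zero_iff_mem.2 hmem, map_zero]
  have hΦM : Φ (map (algebraMap (MvPolynomial σ F) (FractionRing (MvPolynomial σ F)))
      (map (algebraMap F (MvPolynomial σ F)) (M i))) = aeval (fun j => Φ (X j)) (M i) := by
    rw [map_map, ← IsScalarTower.algebraMap_eq]
    conv_lhs => rw [aeval_unique Φ]
    rw [aeval_map_algebraMap]
    rfl
  have hΦL : Φ (map (algebraMap (MvPolynomial σ F) (FractionRing (MvPolynomial σ F))) (C (L i))) =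
      algebraMap (MvPolynomial σ F) (AlgebraicClosure (FractionRing (MvPolynomial σ F))) (L i) := by
    rw [map_C, ← algebraMap_eq (R := FractionRing (MvPolynomial σ F)), AlgHom.commutes,
      ← IsScalarTower.algebraMap_apply]
  rw [fibreEqn, map_sub, map_sub, hΦM, hΦL, sub_eq_zero] at hΦ0
  exact hΦ0

end Literature.RingTheory.PolynomialMaps
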